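import Literature.GroupTheory.CombinatorialGroupTheory.RibbonBoundaryOneFace
import HarnessLib

/-!
# Boundary normal form of a one-vertex ribbon graph, II-a: the separating edge and the glued system

Topic `Literature/GroupTheory/CombinatorialGroupTheory`; continues `RibbonBoundaryOneFace.lean`,
prepares `RibbonBoundaryNormalForm.lean`.  For a one-vertex face system `Fs` (letters pairwise
distinct, exactly the letters with symbol in `S`, vertex permutation `sysPerm Fs` transitive,
no empty face) with at least two faces we show (ZVC 3.1.5):

* `exists_faces_of_two_le` — some edge `y` has its two sides on DIFFERENT faces `Φ ∋ y`, `r ∋ ȳ`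
  (otherwise the vertex permutation would preserve every face), and `Fs ~ Φ :: r :: Gs`;
* `glue_prelim` — writing `Φ = P y Q`, `r = P' ȳ Q'`, the GLUED system `(Q P Q' P') :: Gs`
  (rotate both faces so that `y`, `ȳ` come last and glue them along `y`,
  `sysPerm_glue_transitive`) is again a one-vertex system, over the symbols `S ∖ {y}`, with no
  empty face unless it is the disc `[[]]`.

Small tools for the cusp bookkeeping (`lift_prod_genC_eq`: the image of `∏ c_j` read off a list)
are also here.  Theorems only.

## References

* H. Zieschang, E. Vogt, H.-D. Coldewey, *Surfaces and Planar Discontinuous Groups*, LNM 835,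
  Springer 1980, 3.1.5–3.1.8. [ZieschangVogtColdewey1980]
-/

namespace Literature.GroupTheory.CombinatorialGroupTheory

open List Equiv Equiv.Perm Function

universe u

variable {ι : Type u} [DecidableEq ι]

/-! ### Small tools -/

omit [DecidableEq ι] in
/-- Two letters with the same symbol are equal or partners. [cite: ZieschangVogtColdewey1980, 3.1.1] -/
theorem eq_or_eq_bar_of_fst_eq {x y : ι × Bool} (h : x.1 = y.1) : x = y ∨ x = bar y := by
  obtain ⟨i, b⟩ := x
  obtain ⟨j, c⟩ := y
  simp only at h
  subst h
  cases b <;> cases c <;> simp [bar]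

omit [DecidableEq ι] in
/-- `mk [ȳ] = (mk [y])⁻¹` in the free group. [cite: ZieschangVogtColdewey1980, 3.1.1] -/
theorem mk_bar_singleton (y : ι × Bool) :
    FreeGroup.mk [bar y] = (FreeGroup.mk [y])⁻¹ := by
  rw [FreeGroup.inv_mk]; rfl

/-- Reading a list through `finRange` of its length. [cite: ZieschangVogtColdewey1980, 3.1.1] -/
theorem map_get_cast_finRange {α : Type*} (l : List α) {n : ℕ} (h : l.length = n) :
    (List.finRange n).map (fun j => l.get (Fin.cast h.symm j)) = l := by
  subst h
  rw [← List.ofFn_eq_map]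
  exact List.ofFn_get l

/-- The image of `∏_{j<r} c_j` under an assignment reading the `c`-generators off a list `M` of
length `r` is `M.prod`. [cite: ZieschangVogtColdewey1980, 3.1.8] -/
theorem lift_prod_genC_eq {G : Type*} [Group G] (g r : ℕ) (f : puncturedSurfaceGen g r → G)
    (M : List G) (hM : M.length = r) (hf : ∀ j : Fin r, f (Sum.inr j) = M.get (Fin.cast hM.symm j)) :
    FreeGroup.lift f (((List.finRange r).map fun j => PuncturedSurfaceGroup.genC (g := g) j).prod) =
      M.prod := by
  rw [map_list_prod, List.map_map]
  have : (⇑(FreeGroup.lift f) ∘ fun j => PuncturedSurfaceGroup.genC (g := g) j) =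
      fun j => M.get (Fin.cast hM.symm j) := by
    funext j
    rw [Function.comp_apply, PuncturedSurfaceGroup.genC, FreeGroup.lift_apply_of, hf]
  rw [this, map_get_cast_finRange M hM]

/-! ### An edge with its two sides on different faces -/

/-- **In a one-vertex system with at least two (non-empty) faces some edge separates two different
faces**: there are faces `Φ ∋ y` and `r ∋ ȳ` and the system is, up to the order of the faces,
`Φ :: r :: Gs`.  (If every face contained the partners of all its letters, the vertex permutation
would preserve each face and could not be transitive.) [cite: ZieschangVogtColdewey1980, 3.1.5] -/
theorem exists_faces_of_two_le [Fintype ι] {Fs : List (List (ι × Bool))} (hd : Fs.flatten.Nodup)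
    (hc : Closed Fs.flatten)
    (hV : ∀ x ∈ Fs.flatten, ∀ z ∈ Fs.flatten, (sysPerm Fs).SameCycle x z)
    (hne : [] ∉ Fs) (h2 : 2 ≤ Fs.length) :
    ∃ (Φ r : List (ι × Bool)) (Gs : List (List (ι × Bool))) (y : ι × Bool),
      Fs ~ Φ :: r :: Gs ∧ y ∈ Φ ∧ bar y ∈ r := by
  classical
  -- some face does not contain the partner of one of its letters
  have key : ∃ Φ ∈ Fs, ∃ y ∈ Φ, bar y ∉ Φ := by
    by_contra H
    simp only [not_exists, not_and, not_not] at H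
    obtain ⟨Φ₀, Φ₁, rest, rfl⟩ : ∃ Φ₀ Φ₁ rest, Fs = Φ₀ :: Φ₁ :: rest := by
      match Fs, h2 with
      | Φ₀ :: Φ₁ :: rest, _ => exact ⟨Φ₀, Φ₁, rest, rfl⟩
    have hΦ₀ : Φ₀ ∈ Φ₀ :: Φ₁ :: rest := by simp
    have h0 : Φ₀ ≠ [] := fun h => hne (by rw [← h]; exact hΦ₀)
    have h1 : Φ₁ ≠ [] := fun h => hne (by rw [← h]; simp)
    obtain ⟨x, hx⟩ := exists_mem_of_ne_nil Φ₀ h0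
    obtain ⟨z, hz⟩ := exists_mem_of_ne_nil Φ₁ h1
    have hxF : x ∈ (Φ₀ :: Φ₁ :: rest).flatten := mem_flatten.2 ⟨Φ₀, hΦ₀, hx⟩
    have hzF : z ∈ (Φ₀ :: Φ₁ :: rest).flatten := mem_flatten.2 ⟨Φ₁, by simp, hz⟩
    obtain ⟨n, hn⟩ := (hV x hxF z hzF).exists_nat_pow_eq
    -- the vertex permutation preserves `Φ₀`
    have stay : ∀ (n : ℕ) (v : ι × Bool), v ∈ Φ₀ → (sysPerm (Φ₀ :: Φ₁ :: rest) ^ n) v ∈ Φ₀ := by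
      intro n
      induction n with
      | zero => intro v hv; exact hv
      | succ n ih =>
        intro v hv
        rw [pow_succ', Perm.mul_apply, sysPerm_apply_of_bar_mem hd hΦ₀ (H Φ₀ hΦ₀ _ (ih v hv))]
        exact formPerm_apply_mem_of_mem (H Φ₀ hΦ₀ _ (ih v hv))
    have hz0 : z ∈ Φ₀ := by rw [← hn]; exact stay n x hx
    rw [flatten_cons] at hd
    exact (disjoint_of_nodup_append hd) hz0 (by rw [flatten_cons]; exact mem_append_left _ hz)
  obtain ⟨Φ, hΦ, y, hy, hyΦ⟩ := key
  obtain ⟨r, hr, hyr⟩ := mem_flatten.1 (hc y (mem_flatten.2 ⟨Φ, hΦ, hy⟩))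
  have hrΦ : r ≠ Φ := fun h => hyΦ (h ▸ hyr)
  refine ⟨Φ, r, (Fs.erase Φ).erase r, y, ?_, hy, hyr⟩
  have h1 : Fs ~ Φ :: Fs.erase Φ := perm_cons_erase hΦ
  have h2 : Fs.erase Φ ~ r :: (Fs.erase Φ).erase r := perm_cons_erase ((mem_erase_of_ne hrΦ).2 hr)
  exact h1.trans (Perm.cons Φ h2)

/-! ### The glued system -/

/-- **The glued system** (ZVC 3.1.5): for a one-vertex system `Φ :: r :: Gs` over the symbols `S`
with an edge `y ∈ Φ = P y Q`, `ȳ ∈ r = P' ȳ Q'`, the system `(Q P Q' P') :: Gs` obtained by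
rotating the two faces to `Q P y`, `Q' P' ȳ` and gluing them along `y` has pairwise distinct
letters, exactly the letters with symbol in `S ∖ {y}`, a transitive vertex permutation, and no
empty face unless it is `[[]]`. [cite: ZieschangVogtColdewey1980, 3.1.5] -/
theorem glue_prelim [Fintype ι] (S : Finset ι) (Φ r : List (ι × Bool))
    (Gs : List (List (ι × Bool))) (y : ι × Bool) (hy : y ∈ Φ) (hy' : bar y ∈ r)
    (hd : (Φ :: r :: Gs).flatten.Nodup) (hS : ∀ x : ι × Bool, x ∈ (Φ :: r :: Gs).flatten ↔ x.1 ∈ S)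
    (hV : ∀ x ∈ (Φ :: r :: Gs).flatten, ∀ z ∈ (Φ :: r :: Gs).flatten,
      (sysPerm (Φ :: r :: Gs)).SameCycle x z)
    (hne : [] ∉ (Φ :: r :: Gs)) :
    ∃ P Q P' Q' : List (ι × Bool), Φ = P ++ y :: Q ∧ r = P' ++ bar y :: Q' ∧
      ((Q ++ P ++ (Q' ++ P')) :: Gs).flatten.Nodup ∧
      (∀ x : ι × Bool, x ∈ ((Q ++ P ++ (Q' ++ P')) :: Gs).flatten ↔ x.1 ∈ S.erase y.1) ∧
      (∀ x ∈ ((Q ++ P ++ (Q' ++ P')) :: Gs).flatten, ∀ z ∈ ((Q ++ P ++ (Q' ++ P')) :: Gs).flatten,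
        (sysPerm ((Q ++ P ++ (Q' ++ P')) :: Gs)).SameCycle x z) ∧
      ([] ∉ ((Q ++ P ++ (Q' ++ P')) :: Gs) ∨ ((Q ++ P ++ (Q' ++ P')) :: Gs) = [[]]) := by
  classical
  have hΦF : ∀ x ∈ Φ, x ∈ (Φ :: r :: Gs).flatten := fun x hx => mem_flatten.2 ⟨Φ, by simp, hx⟩

  -- (1) rotate the two faces so that `y`, `ȳ` come last
  obtain ⟨P, Q, hPQ⟩ := append_of_mem hy
  obtain ⟨P', Q', hPQ'⟩ := append_of_mem hy'
  set A := Q ++ P with hA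
  set C := Q' ++ P' with hC
  have hrotΦ : Φ ~r (A ++ [y]) := by
    rw [hPQ, hA]
    exact (isRotated_append (l := P) (l' := y :: Q)).trans
      (by simpa using (isRotated_append (l := [y]) (l' := Q ++ P)))
  have hrotr : r ~r (C ++ [bar y]) := by
    rw [hPQ', hC]
    exact (isRotated_append (l := P') (l' := bar y :: Q')).trans
      (by simpa using (isRotated_append (l := [bar y]) (l' := Q' ++ P')))
  have hdΦ : Φ.Nodup := by
    rw [flatten_cons] at hd; exact (nodup_append.1 hd).1
  have hdr : r.Nodup := by
    rw [flatten_cons, flatten_cons] at hd; exact (nodup_append.1 (nodup_append.1 hd).2.1).1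
  set Fs₃ : List (List (ι × Bool)) := (A ++ [y]) :: (C ++ [bar y]) :: Gs with hFs₃
  have hperm3 : (Φ :: r :: Gs).flatten ~ Fs₃.flatten := by
    simp only [hFs₃, flatten_cons]
    exact hrotΦ.perm.append (hrotr.perm.append (Perm.refl _))
  have hd₃ : Fs₃.flatten.Nodup := hperm3.nodup_iff.1 hd
  have hsys3 : sysPerm (Φ :: r :: Gs) = sysPerm Fs₃ := by
    have e1 : sysPerm (Φ :: r :: Gs) = sysPerm ((A ++ [y]) :: r :: Gs) :=
      sysPerm_cons_eq_of_isRotated (r :: Gs) hdΦ hrotΦ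
    have hd1 : ((A ++ [y]) :: r :: Gs).flatten.Nodup := by
      have : (Φ :: r :: Gs).flatten ~ ((A ++ [y]) :: r :: Gs).flatten := by
        simp only [flatten_cons]; exact hrotΦ.perm.append (Perm.refl _)
      exact this.nodup_iff.1 hd
    have e2 : sysPerm ((A ++ [y]) :: r :: Gs) = sysPerm (r :: (A ++ [y]) :: Gs) :=
      sysPerm_eq_of_perm hd1 (Perm.swap _ _ _).symm
    have e3 : sysPerm (r :: (A ++ [y]) :: Gs) = sysPerm ((C ++ [bar y]) :: (A ++ [y]) :: Gs) :=
      sysPerm_cons_eq_of_isRotated ((A ++ [y]) :: Gs) hdr hrotr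
    have hd3' : ((C ++ [bar y]) :: (A ++ [y]) :: Gs).flatten.Nodup := by
      have : Fs₃.flatten ~ ((C ++ [bar y]) :: (A ++ [y]) :: Gs).flatten := (Perm.swap _ _ _).symm.flatten
      exact this.nodup_iff.1 hd₃
    have e4 : sysPerm ((C ++ [bar y]) :: (A ++ [y]) :: Gs) = sysPerm Fs₃ :=
      sysPerm_eq_of_perm hd3' (Perm.swap _ _ _)
    rw [e1, e2, e3, e4]
  have hV₃ : ∀ x ∈ Fs₃.flatten, ∀ z ∈ Fs₃.flatten, (sysPerm Fs₃).SameCycle x z :=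
    fun x hx z hz => by
      rw [← hsys3]; exact hV x (hperm3.symm.mem_iff.1 hx) z (hperm3.symm.mem_iff.1 hz)
  -- (2) glue
  set Fs' : List (List (ι × Bool)) := (A ++ C) :: Gs with hFs'
  have hV' : ∀ x ∈ Fs'.flatten, ∀ z ∈ Fs'.flatten, (sysPerm Fs').SameCycle x z :=
    sysPerm_glue_transitive hd₃ hV₃
  have hperm' : Fs₃.flatten ~ y :: bar y :: Fs'.flatten := by
    simp only [hFs₃, hFs', flatten_cons, append_assoc, cons_append, nil_append]
    refine (perm_middle (a := y) (l₁ := A) (l₂ := C ++ bar y :: Gs.flatten)).trans (Perm.cons y ?_)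
    rw [← append_assoc]
    exact perm_middle.trans (by rw [append_assoc])
  have hd'' : (y :: bar y :: Fs'.flatten).Nodup := hperm'.nodup_iff.1 hd₃
  have hyF' : y ∉ Fs'.flatten := fun h => (nodup_cons.1 hd'').1 (mem_cons_of_mem _ h)
  have hyF'' : bar y ∉ Fs'.flatten := (nodup_cons.1 (nodup_cons.1 hd'').2).1
  have hd' : Fs'.flatten.Nodup := (nodup_cons.1 (nodup_cons.1 hd'').2).2
  have hyS : y.1 ∈ S := (hS y).1 (hΦF y hy)
  have hS' : ∀ x : ι × Bool, x ∈ Fs'.flatten ↔ x.1 ∈ S.erase y.1 := by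
    intro x
    rw [Finset.mem_erase]
    constructor
    · intro hx
      have hx3 : x ∈ Fs₃.flatten := hperm'.symm.mem_iff.1 (mem_cons_of_mem _ (mem_cons_of_mem _ hx))
      refine ⟨fun h => ?_, (hS x).1 (hperm3.symm.mem_iff.1 hx3)⟩
      rcases eq_or_eq_bar_of_fst_eq h with rfl | rfl
      · exact hyF' hx
      · exact hyF'' hx
    · rintro ⟨hne1, hxS⟩
      have hx3 : x ∈ Fs₃.flatten := hperm3.mem_iff.1 ((hS x).2 hxS)
      rcases mem_cons.1 (hperm'.mem_iff.1 hx3) with rfl | hx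
      · exact absurd rfl hne1
      rcases mem_cons.1 hx with rfl | hx
      · exact absurd rfl hne1
      exact hx
  have hGs : [] ∉ Gs := fun h => hne (by simp [h])
  have hne' : [] ∉ Fs' ∨ Fs' = [[]] := by
    by_cases hAC : A ++ C = []
    · right
      obtain ⟨hA0, hC0⟩ := append_eq_nil_iff.1 hAC
      suffices hG : Gs = [] by simp [hFs', hAC, hG]
      by_contra hG
      obtain ⟨G, hG1⟩ := exists_mem_of_ne_nil Gs hG
      obtain ⟨z, hz⟩ := exists_mem_of_ne_nil G (fun h => hGs (h ▸ hG1))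
      have hzG : z ∈ Gs.flatten := mem_flatten.2 ⟨G, hG1, hz⟩
      have hy3 : y ∈ Fs₃.flatten := hperm'.symm.mem_iff.1 (by simp)
      have hz3 : z ∈ Fs₃.flatten := by simp [hFs₃, flatten_cons, hzG]
      obtain ⟨n, hn⟩ := (hV₃ y hy3 z hz3).exists_nat_pow_eq
      have hface1 : C ++ [bar y] ∈ Fs₃ := by simp [hFs₃]
      have hface0 : A ++ [y] ∈ Fs₃ := by simp [hFs₃]
      have hsy : sysPerm Fs₃ y = bar y := by
        rw [sysPerm_apply_of_bar_mem hd₃ hface1 (by simp), hC0]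
        simp
      have hsy' : sysPerm Fs₃ (bar y) = y := by
        rw [sysPerm_apply_of_bar_mem hd₃ hface0 (by simp), hA0]
        simp
      have stay : ∀ n : ℕ, (sysPerm Fs₃ ^ n) y = y ∨ (sysPerm Fs₃ ^ n) y = bar y := by
        intro n
        induction n with
        | zero => exact Or.inl rfl
        | succ n ihn =>
          rw [pow_succ', Perm.mul_apply]
          rcases ihn with h | h
          · rw [h, hsy]; exact Or.inr rfl
          · rw [h, hsy']; exact Or.inl rfl
      have hzGs' : z ∈ Fs'.flatten := by simp [hFs', flatten_cons, hzG]
      rcases stay n with h | h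
      · exact hyF' ((hn.symm.trans h) ▸ hzGs')
      · exact hyF'' ((hn.symm.trans h) ▸ hzGs')
    · left
      simp only [hFs', mem_cons, not_or]
      exact ⟨fun h => hAC h.symm, hGs⟩
  exact ⟨P, Q, P', Q', hPQ, hPQ', hd', hS', hV', hne'⟩

end Literature.GroupTheory.CombinatorialGroupTheory
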